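import Literature.AlgebraicGeometry.Motives.AbelianVarietyDualQuotient
import Literature.AlgebraicGeometry.Motives.AbelianVarietyPrincipalPolarization
import Literature.AlgebraicGeometry.Motives.JacobianThetaDivisor
import Literature.AlgebraicGeometry.Markman2025.EquivarianceGroupTranslationProjection
import HarnessLib

/-!
# Markman's secant-quotient carrier at SCHEME level: the group `Ḡ ⊂ (X × X̂)[n]`, the quotient sixfold
# `Y = (X × X̂)/Ḡ`, its isogeny `q`, and the split Weil operator — REAL carriers (arXiv:2502.03415 §1.5, §9.3)

Layer `Literature/AlgebraicGeometry/Markman2025`, namespace `Literature.AlgebraicGeometry.Markman2025` (+ two dot-notation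
extensions of `Motives.AbelianVariety` in §0). Typer seat `hodge-lit-avcarriers` (cell `pub-hodge-ring2`, ask
`LEAD/ASK#carriers-secant-anchor` item (d): "Markman's groups `G₁ × G₂` and their Rouquier image `Ḡ` in `X × X̂` (§9.3)" as an
interface over the quotient carrier). UNLIKE the rest of `Literature/AlgebraicGeometry/Markman2025/` (abstract-carrier
ARCHITECTURE files), everything here lives on the tree's REAL carriers: `Motives.AbelianVariety ℂ`, its complex points
`A.Points ℂ`, Cartier divisors, `A.dualOf Θ` (`= A/K(Θ)`, `Motives/AbelianVarietyDualQuotient`), `A.torsionQuot`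
(`Motives/AbelianVarietyTorsionQuotient`), `complexBetti`. NOTHING here asserts any statement of the preprint: every
declaration is a definition with a body or a proved structural lemma; the preprint is cited for the SHAPE of the objects.

## Source, verbatim (E. Markman, *Cycles on abelian 2n-folds of Weil type from secant sheaves on abelian n-folds*,
## arXiv:2502.03415v2, UNREFEREED; held text `paper:arxiv-2502.03415`) [Markman2025SecantWeil]

§1.5 (p. 7): "Let `G₁` and `G₂` be cyclic subgroups of `X` of order `d+1` with `G₁ ∩ G₂ = (0)`. Choose `C_i ⊂ X`, `1 ≤ i ≤ d+1`,
to be a `G₁`-orbit of translates of the Abel-Jacobi image `AJ(C)` of `C`. Choose `Σ_i ⊂ X` … a `G₂`-orbit of translates of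
`−AJ(C)` … `𝓔^∨` is thus equivariant with respect to the image `G ⊂ (X × X̂) × Pic⁰(X × X̂)` of `G₁ × G₂` via the Rouqier
isomorphism … Denote by `Ḡ` the image of `G` via the projection to the cartesian factor `X × X̂`. The projection `G → Ḡ` is
an isomorphism, by Lemma 9.3.3. Let `q : X × X̂ → Y := (X × X̂)/Ḡ` be the quotient morphism. When `d` is even [footnote: If
`d` is odd replace it with `4d` …] the rank `8d` of `𝓔` is relatively prime to the order `(d+1)²` of `Ḡ`."
§9.3 (p. 70): "Set `n := d+1`. Choose `∪C_i` and `∪Σ_i` to each be equivariant with respect to a subgroup `G_i`, `i = 1,2`,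
of `X` of order `n` …"; Lemma 9.3.1: "A generic `C` admits subgroups `G₁` and `G₂` of `Pic⁰(C)`, such that Assumption 9.2.1
holds for a `G₁` orbit … and a `G₂` orbit …" (proof: "it suffices to prove the existence of `G₁` and `G₂`, such that the
intersection of any four translates `τ_{g₁+g₂}(Θ)`, `(g₁, g₂) ∈ G₁ × G₂`, is empty and any three translates have finite
intersection"); (p. 71) "Let `Ḡ` be the projection of `G` to `X × X̂`, considered as the group of translation automorphisms
of `X × X̂`." Lemma 9.3.3: "If the intersection `G₁ ∩ G₂` does not contain an element of order `2`, then the projection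
`p : G → Ḡ` is an isomorphism." Proof, displayed equation (9.x): "`Φ̃ ∘ (τ_{x₁}, τ_{x₂})_* ∘ Φ̃⁻¹ ≅ ((π₁^*L_{x₁} ⊗ π₂^*𝒫_{−x₂})
⊗) ∘ (τ_{x₁−x₂}, τ_{L_{x₁+x₂}})_*`. The element `(τ_{x₁−x₂}, τ_{L_{x₁+x₂}})` of `Ḡ` is the identity, if and only if `x₁ = x₂` and
`x₁ + x₂ = 0`, so that `x₁` is a point of order `2` of `G₁ ∩ G₂`", where (p. 71) "`L_x := Θ ⊗ τ_{x,*}(Θ)⁻¹ ≅ τ_x^*(Θ) ⊗ Θ⁻¹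
=: φ_Θ(x)`" and "`τ_{L_x,*}` [is] translation by the point of `X̂` corresponding to the isomorphism class of `L_x`".
§3.2 / the tree's `HodgeTheory/WeilClassesLocalAnchor` (witness paragraph): `η(√−d) = φ_d : (x, y) ↦ (−d θ⁻¹ y, θ x)` on
`X × X̂`, `θ = φ_Θ : X ⥲ X̂` for the principal polarization `Θ` (Markman p. 16: "`−θ` is the pullback homomorphism associated
to the isogeny `φ_L : X → X̂`").

## What is typed (all definitions with bodies / proved lemmas; NO named fact, no instance, no notation)

§0 (dot-notation on `Motives.AbelianVariety`, any field): `pointsProdEquiv : (A × B)(L) ≃* A(L) × B(L)` (points of a product are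
pairs of points; Milne AV I §1 / Mathlib's cartesian structure), `pointsProdEquiv_symm_mem_torsionPoints`.
§1 For a complex abelian variety `A`, an ample `Θ` (so `Â = A.dualOf Θ hΘ`, `φ_Θ = A.phiTheta Θ hΘ`) and subgroups
`G₁ G₂ ≤ A(ℂ)`: `rouquierShear A hΘ : A(ℂ) × A(ℂ) →* (A × Â)(ℂ)`, **`(x₁, x₂) ↦ (x₁ − x₂, φ_Θ(x₁ + x₂))`** (Markman's
`(τ_{x₁−x₂}, τ_{L_{x₁+x₂}})`, written multiplicatively in the tree's groups of points); `rouquierImage A hΘ G₁ G₂ ≤ (A × Â)(ℂ)`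
— **`Ḡ`, the image of `G₁ × G₂`**; PROVED: `rouquierImage_le_torsionPoints` (`G₁, G₂ ⊆ A[n] ⟹ Ḡ ⊆ (A × Â)[n]`),
`finite_rouquierImage`, and **Lemma 9.3.3** in the principal case: `rouquierShear_injOn` (if `K(Θ) = 0` and `G₁ ∩ G₂` has no
element of order `2`, the shear is injective on `G₁ × G₂`) with `natCard_rouquierImage` (**`#Ḡ = #G₁ · #G₂`**, "the order
`(d+1)²` of `Ḡ`").
§2 `secantQuotient A hΘ hn G₁ G₂ h₁ h₂ : AbelianVariety ℂ` — **`Y := (A × Â)/Ḡ`** (the tree's `torsionQuot`) with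
`secantQuotientMap` — **`q : A × Â → Y`**; PROVED: `q` is an isogeny with `Ker q (ℂ) = Ḡ`, `dim Y = 2 dim A`, `q^*` bijective on
`H^*(–(ℂ); ℂ)` and on rational `(p,p)`-classes (so a class `h_Y` on `Y` is the same datum as `q^*h_Y` on `A × Â`), and the
factorisation `q ≫ r = [n]`.
§3 `weilOperator A hΘ hK d : A × Â ⟶ A × Â` — **`φ_d : (x, y) ↦ (−d·φ_Θ⁻¹ y, φ_Θ x)`** for `Θ` principal (`hK : K(Θ) = 0`, so
`φ_Θ` is invertible); PROVED `weilOperator_comp_self : φ_d ≫ φ_d = −(d • 𝟙)` (**`η(√−d)² = −d`**), and the descent lemma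
`comp_self_of_descent` (`ψ ≫ ψ = c • 𝟙` on `A × Â` and `q ≫ r = n • 𝟙` give `(r ≫ ψ ≫ q)² = (n·n·c) • 𝟙` on `Y` — the
`K`-action on `Y` "up to the isogeny `q`").
§4 Predicates for the genus-3 anchor, for the ring-2 consumers: `thetaTranslate`, `TranslatesInGeneralPosition A Θ S` (the
TYPABLE content of Lemma 9.3.1 / Assumption 9.2.1 (1): any four distinct translates `τ_s(Supp Θ)`, `s ∈ S`, have empty
intersection and any three have finite intersection), and `IsSecantQuotientSixfold d Y` — **`Y ≅ (J × Ĵ)/Ḡ` for `J` the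
Jacobian of a smooth projective complex curve of genus `3` principally polarized by a Riemann theta divisor `Θ`
(`Motives/JacobianThetaDivisor`), `G₁, G₂ ≤ J[d+1](ℂ)` cyclic of order `d+1` with `G₁ ⊓ G₂ = ⊥`** — the SHAPE of Markman's
anchor `Y_d`. HONEST SCOPE NOTE: Markman's anchors are these `Y` for `C` GENERIC NON-HYPERELLIPTIC and `G₁, G₂` as in Lemma 9.3.1
(general position of the `(d+1)²` translates of `Θ`) with `d` even `≥ 4`; `IsSecantQuotientSixfold` is the typable ENVELOPE
(a superset): a universally quantified claim over it would be STRONGER than the preprint (ring2 INBOX l.4931 F4 (ii)); the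
general-position part is offered separately as `TranslatesInGeneralPosition` so that a consumer can conjoin it, and
"generic"/"non-hyperelliptic" are NOT typed (no moduli of curves / `g¹₂` on the tree's carriers).

## References
* [Markman2025SecantWeil] E. Markman, arXiv:2502.03415v2 (2025), §1.5 (p. 7), §3.2, §9.1 Assumption 9.1.1 / Lemma 9.1.2,
  §9.2 Assumption 9.2.1, §9.3 Lemma 9.3.1, Lemma 9.3.3, Lemma 9.3.4. UNREFEREED PREPRINT — cited for the shape of the objects only.
* [MilneAV2008] J. S. Milne, *Abelian Varieties* (2008), I §7 (isogenies, `A_n`), I §8 Rem. 8.12 (quotients by finite subgroups).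
* [Lange2023AbelianVarietiesComplex] H. Lange, *Abelian Varieties over the Complex Numbers* (2023), §1.4.2 (`φ_L`, `K(L)`),
  §2.1.1, §5.2 (abelian varieties of Weil type: not used, orientation only).
* [MumfordAV1970] D. Mumford, *Abelian Varieties* (1970), §7 Thm. 4 (quotient by a finite subgroup), §19 (quasi-inverse of an isogeny).
* [vanGeemen1994HodgeAV] B. van Geemen, *An introduction to the Hodge conjecture for abelian varieties* (1994), §3.6
  (isogenies induce isomorphisms on rational cohomology and on Hodge classes).
* Tree: `Markman2025/EquivarianceGroupTranslationProjection` (the abstract group arithmetic of Lemma 9.3.3, REUSED in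
  `rouquierShear_injOn`), `Motives/AbelianVarietyTorsionQuotient`, `Motives/AbelianVarietyDualQuotient`,
  `Motives/AbelianVarietyPrincipalPolarization`, `Motives/JacobianThetaDivisor` (typer seat `hodge-lit-avcarriers`).
-/

noncomputable section

universe u

open CategoryTheory AlgebraicGeometry MonoidalCategory

/-! ## §0 Points of a product of abelian varieties (any field) -/

namespace Literature.AlgebraicGeometry.Motives

namespace AbelianVariety

open scoped MonObj

section Points

variable {k : Type u} [Field k] (A B : AbelianVariety k) (L : Type u) [Field L] [Algebra k L]

/-- The two projections on `L`-points, `z ↦ (p(z), q(z))`, as a homomorphism `(A × B)(L) → A(L) × B(L)`.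
[cite: Milne1986AbelianVarieties, Conventions p. 103 (the projections p, q of A × B)] -/
def pointsProj : (A.prod B).Points L →* A.Points L × B.Points L :=
  (IsMonHom.monoidHom (fst A B).hom.hom.hom (specOver k L)).prod
    (IsMonHom.monoidHom (snd A B).hom.hom.hom (specOver k L))

/-- `pointsProj z = (z ≫ p, z ≫ q)`. [cite: Milne1986AbelianVarieties, Conventions p. 103] -/
theorem pointsProj_apply (z : (A.prod B).Points L) :
    A.pointsProj B L z = (z ≫ (fst A B).hom.hom.hom, z ≫ (snd A B).hom.hom.hom) :=
  rfl

/-- A point of `A × B` is determined by its two projections. [cite: Milne1986AbelianVarieties, Conventions p. 103] -/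
theorem pointsProj_injective : Function.Injective (A.pointsProj B L) := by
  intro z z' h
  simp only [pointsProj_apply, Prod.mk.injEq] at h
  exact CartesianMonoidalCategory.hom_ext (f := (z : specOver k L ⟶ A.X ⊗ B.X))
    (g := (z' : specOver k L ⟶ A.X ⊗ B.X)) h.1 h.2

/-- Every pair of points `(x, y)` is the pair of projections of the point `(x, y)` of `A × B`.
[cite: Milne1986AbelianVarieties, Conventions p. 103] -/
theorem pointsProj_surjective : Function.Surjective (A.pointsProj B L) := by
  rintro ⟨x, y⟩
  refine ⟨(CartesianMonoidalCategory.lift x y : specOver k L ⟶ A.X ⊗ B.X), ?_⟩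
  simp only [pointsProj_apply, Prod.mk.injEq]
  exact ⟨CartesianMonoidalCategory.lift_fst x y, CartesianMonoidalCategory.lift_snd x y⟩

/-- **`(A × B)(L) ≃* A(L) × B(L)`**: the `L`-points of a product of abelian varieties are the pairs of `L`-points, as
groups (the product is the categorical product of `k`-group schemes). [cite: Milne1986AbelianVarieties, Conventions p. 103 and §1 p. 104] -/
def pointsProdEquiv : (A.prod B).Points L ≃* A.Points L × B.Points L :=
  MulEquiv.ofBijective (A.pointsProj B L) ⟨A.pointsProj_injective B L, A.pointsProj_surjective B L⟩

/-- `pointsProdEquiv z = (z ≫ p, z ≫ q)`. [cite: Milne1986AbelianVarieties, Conventions p. 103] -/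
theorem pointsProdEquiv_apply (z : (A.prod B).Points L) :
    A.pointsProdEquiv B L z = (z ≫ (fst A B).hom.hom.hom, z ≫ (snd A B).hom.hom.hom) :=
  rfl

/-- The point `(x, y)` of `A × B` projects to `x`. [cite: Milne1986AbelianVarieties, Conventions p. 103] -/
theorem pointsProdEquiv_symm_comp_fst (x : A.Points L) (y : B.Points L) :
    ((A.pointsProdEquiv B L).symm (x, y) : (A.prod B).Points L) ≫ (fst A B).hom.hom.hom = x :=
  congrArg Prod.fst ((A.pointsProdEquiv B L).apply_symm_apply (x, y))

/-- The point `(x, y)` of `A × B` projects to `y`. [cite: Milne1986AbelianVarieties, Conventions p. 103] -/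
theorem pointsProdEquiv_symm_comp_snd (x : A.Points L) (y : B.Points L) :
    ((A.pointsProdEquiv B L).symm (x, y) : (A.prod B).Points L) ≫ (snd A B).hom.hom.hom = y :=
  congrArg Prod.snd ((A.pointsProdEquiv B L).apply_symm_apply (x, y))

/-- **`A[n](L) × B[n](L) ⊆ (A × B)[n](L)`**: a pair of `n`-torsion points is an `n`-torsion point of the product.
[cite: MilneAV2008, I §7 (p. 32: A_n)] -/
theorem pointsProdEquiv_symm_mem_torsionPoints {n : ℤ} {x : A.Points L} {y : B.Points L}
    (hx : x ∈ A.torsionPoints L n) (hy : y ∈ B.torsionPoints L n) :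
    (A.pointsProdEquiv B L).symm (x, y) ∈ (A.prod B).torsionPoints L n := by
  rw [mem_torsionPoints_iff] at hx hy ⊢
  rw [← map_zpow, Prod.pow_mk, hx, hy, ← Prod.one_eq_mk, map_one]

end Points

end AbelianVariety

end Literature.AlgebraicGeometry.Motives

/-! ## §1 Markman's shear `(x₁, x₂) ↦ (x₁ − x₂, φ_Θ(x₁ + x₂))` and the group `Ḡ` -/

namespace Literature.AlgebraicGeometry.Markman2025

open Literature.AlgebraicGeometry.Motives Literature.AlgebraicGeometry.Motives.AbelianVariety
open Literature.AlgebraicGeometry.HodgeTheory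
open scoped MonObj

variable (A : AbelianVariety ℂ) {Θ : CartierDivisor A.X.left} (hΘ : Θ.IsAmple)

/-- `φ_Θ(ℂ) : A(ℂ) → Â(ℂ)` on complex points (a group homomorphism). [cite: Lange2023AbelianVarietiesComplex, §1.4.2 (p. 37)] -/
abbrev phiThetaPoints : A.Points ℂ →* (A.dualOf Θ hΘ).Points ℂ :=
  IsMonHom.monoidHom (A.phiTheta Θ hΘ).hom.hom.hom (specOver ℂ ℂ)

/-- **Markman's shear `(x₁, x₂) ↦ (x₁ − x₂, φ_Θ(x₁ + x₂)) ∈ (A × Â)(ℂ)`** (multiplicatively: `(x₁ x₂⁻¹, φ_Θ(x₁ x₂))`), the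
map `G₁ × G₂ → Ḡ`, `(x₁, x₂) ↦ (τ_{x₁−x₂}, τ_{L_{x₁+x₂}})` of the proof of Lemma 9.3.3 (the Rouquier image of
`(τ_{x₁}, τ_{x₂})_*` projected to `X × X̂`, with `L_x ≅ φ_Θ(x)`), as a homomorphism on all of `A(ℂ) × A(ℂ)` (`A(ℂ)` is
commutative). [cite: Markman2025SecantWeil, §9.3 Lemma 9.3.3 (proof, the displayed formula for Φ̃ ∘ (τ_{x₁}, τ_{x₂})_* ∘ Φ̃⁻¹)] -/
def rouquierShear : A.Points ℂ × A.Points ℂ →* (A.prod (A.dualOf Θ hΘ)).Points ℂ :=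
  (A.pointsProdEquiv (A.dualOf Θ hΘ) ℂ).symm.toMonoidHom.comp
    ((MonoidHom.fst (A.Points ℂ) (A.Points ℂ) * (MonoidHom.snd (A.Points ℂ) (A.Points ℂ))⁻¹).prod
      ((phiThetaPoints A hΘ).comp (MonoidHom.fst (A.Points ℂ) (A.Points ℂ) * MonoidHom.snd (A.Points ℂ) (A.Points ℂ))))

/-- The shear on a pair, unfolded. [cite: Markman2025SecantWeil, §9.3 Lemma 9.3.3 (proof)] -/
theorem rouquierShear_apply (x₁ x₂ : A.Points ℂ) :
    rouquierShear A hΘ (x₁, x₂) =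
      (A.pointsProdEquiv (A.dualOf Θ hΘ) ℂ).symm (x₁ * x₂⁻¹, phiThetaPoints A hΘ (x₁ * x₂)) :=
  rfl

/-- The first projection of the sheared point is `x₁ − x₂`. [cite: Markman2025SecantWeil, §9.3 Lemma 9.3.3 (proof)] -/
theorem rouquierShear_comp_fst (x₁ x₂ : A.Points ℂ) :
    (rouquierShear A hΘ (x₁, x₂) : (A.prod (A.dualOf Θ hΘ)).Points ℂ) ≫ (fst A (A.dualOf Θ hΘ)).hom.hom.hom =
      x₁ * x₂⁻¹ :=
  A.pointsProdEquiv_symm_comp_fst _ ℂ _ _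

/-- The second projection of the sheared point is `φ_Θ(x₁ + x₂)`. [cite: Markman2025SecantWeil, §9.3 Lemma 9.3.3 (proof)] -/
theorem rouquierShear_comp_snd (x₁ x₂ : A.Points ℂ) :
    (rouquierShear A hΘ (x₁, x₂) : (A.prod (A.dualOf Θ hΘ)).Points ℂ) ≫ (snd A (A.dualOf Θ hΘ)).hom.hom.hom =
      phiThetaPoints A hΘ (x₁ * x₂) :=
  A.pointsProdEquiv_symm_comp_snd _ ℂ _ _

variable (G₁ G₂ : Subgroup (A.Points ℂ))

/-- **Markman's group `Ḡ ≤ (A × Â)(ℂ)`**: the image of `G₁ × G₂` under the shear `(x₁, x₂) ↦ (x₁ − x₂, φ_Θ(x₁ + x₂))`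
("Denote by `Ḡ` the image of `G` via the projection to the cartesian factor `X × X̂`", §1.5; "`Ḡ ≅ G₁ × G₂`", p. 57; the
group of translation automorphisms by which one divides, `Y = (X × X̂)/Ḡ`). [cite: Markman2025SecantWeil, §1.5 (p. 7) and §9.3 (p. 71, Ḡ)] -/
def rouquierImage : Subgroup ((A.prod (A.dualOf Θ hΘ)).Points ℂ) :=
  (G₁.prod G₂).map (rouquierShear A hΘ)

variable {A hΘ G₁ G₂}

/-- Membership in `Ḡ`. [cite: Markman2025SecantWeil, §9.3 (p. 71)] -/
theorem mem_rouquierImage_iff (z : (A.prod (A.dualOf Θ hΘ)).Points ℂ) :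
    z ∈ rouquierImage A hΘ G₁ G₂ ↔ ∃ x₁ ∈ G₁, ∃ x₂ ∈ G₂, rouquierShear A hΘ (x₁, x₂) = z := by
  simp only [rouquierImage, Subgroup.mem_map, Subgroup.mem_prod, Prod.exists]
  constructor
  · rintro ⟨a, b, ⟨ha, hb⟩, h⟩
    exact ⟨a, ha, b, hb, h⟩
  · rintro ⟨a, ha, b, hb, h⟩
    exact ⟨a, b, ⟨ha, hb⟩, h⟩

/-- The shear of a pair in `G₁ × G₂` lies in `Ḡ`. [cite: Markman2025SecantWeil, §9.3 (p. 71)] -/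
theorem rouquierShear_mem_rouquierImage {x₁ x₂ : A.Points ℂ} (h₁ : x₁ ∈ G₁) (h₂ : x₂ ∈ G₂) :
    rouquierShear A hΘ (x₁, x₂) ∈ rouquierImage A hΘ G₁ G₂ :=
  (mem_rouquierImage_iff _).2 ⟨x₁, h₁, x₂, h₂, rfl⟩

/-- **`G₁, G₂ ⊆ A[n](ℂ) ⟹ Ḡ ⊆ (A × Â)[n](ℂ)`** (`Ḡ` has exponent `n = d+1`: "The group `G` has exponent `n = d+1`", p. 72).
[cite: Markman2025SecantWeil, §9.3 (p. 72: G has exponent n = d+1)] [cite: MilneAV2008, I §7 (p. 32)] -/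
theorem rouquierImage_le_torsionPoints {n : ℕ} (h₁ : G₁ ≤ A.torsionPoints ℂ n) (h₂ : G₂ ≤ A.torsionPoints ℂ n) :
    rouquierImage A hΘ G₁ G₂ ≤ (A.prod (A.dualOf Θ hΘ)).torsionPoints ℂ n := by
  intro z hz
  obtain ⟨x₁, hx₁, x₂, hx₂, rfl⟩ := (mem_rouquierImage_iff z).1 hz
  have e₁ : x₁ ^ (n : ℤ) = 1 := (mem_torsionPoints_iff _ _).1 (h₁ hx₁)
  have e₂ : x₂ ^ (n : ℤ) = 1 := (mem_torsionPoints_iff _ _).1 (h₂ hx₂)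
  rw [mem_torsionPoints_iff, ← map_zpow, Prod.pow_mk, e₁, e₂, ← Prod.one_eq_mk, map_one]

/-- `Ḡ` as a set is the image of `G₁ × G₂` under the shear. [cite: Markman2025SecantWeil, §9.3 (p. 71)] -/
theorem coe_rouquierImage :
    (rouquierImage A hΘ G₁ G₂ : Set ((A.prod (A.dualOf Θ hΘ)).Points ℂ)) =
      rouquierShear A hΘ '' ((G₁ : Set (A.Points ℂ)) ×ˢ (G₂ : Set (A.Points ℂ))) := by
  ext z
  simp only [SetLike.mem_coe, mem_rouquierImage_iff, Set.mem_image, Set.mem_prod, Prod.exists]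
  constructor
  · rintro ⟨a, ha, b, hb, h⟩; exact ⟨a, b, ⟨ha, hb⟩, h⟩
  · rintro ⟨a, b, ⟨ha, hb⟩, h⟩; exact ⟨a, ha, b, hb, h⟩

/-- `Ḡ` is finite when `G₁`, `G₂` are. [cite: Markman2025SecantWeil, §1.5 (p. 7: the order (d+1)² of Ḡ)] -/
theorem finite_rouquierImage [Finite G₁] [Finite G₂] : Finite (rouquierImage A hΘ G₁ G₂) := by
  have h : (rouquierImage A hΘ G₁ G₂ : Set ((A.prod (A.dualOf Θ hΘ)).Points ℂ)).Finite := by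
    rw [coe_rouquierImage]
    exact ((Set.toFinite _).prod (Set.toFinite _)).image _
  exact h.to_subtype

/-- **Lemma 9.3.3 (principal case): if `K(Θ) = 0` and `G₁ ∩ G₂` has no element of order `2`, the shear is injective on
`G₁ × G₂`** ("The element `(τ_{x₁−x₂}, τ_{L_{x₁+x₂}})` of `Ḡ` is the identity, if and only if `x₁ = x₂` and `x₁ + x₂ = 0`,
so that `x₁` is a point of order `2` of `G₁ ∩ G₂`" — with `φ_Θ` injective on points, which is `K(Θ) = 0`). This is the
tree's abstract group-theoretic Lemma 9.3.3 `Markman2025.Lemma933.lemma933` (`EquivarianceGroupTranslationProjection`,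
additive groups, an injective `φ`) INSTANTIATED on the real carriers `A(ℂ)`, `φ_Θ(ℂ)` (proof: transport along `Additive`).
[cite: Markman2025SecantWeil, §9.3 Lemma 9.3.3] -/
theorem rouquierShear_injOn (hK : A.KTheta Θ = ⊥) (h2 : ∀ x ∈ G₁ ⊓ G₂, x ^ 2 = 1 → x = 1) :
    Set.InjOn (rouquierShear A hΘ) ((G₁ : Set (A.Points ℂ)) ×ˢ (G₂ : Set (A.Points ℂ))) := by
  have hinj : Function.Injective (phiThetaPoints A hΘ) := by
    rw [← MonoidHom.ker_eq_bot_iff, A.ker_monoidHom_phiTheta hΘ, hK]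
  -- the abstract Lemma 9.3.3, for the additive copies of `A(ℂ)`, `Â(ℂ)` and `φ = φ_Θ(ℂ)`
  have key := Lemma933.lemma933 (Subgroup.toAddSubgroup G₁) (Subgroup.toAddSubgroup G₂)
    (MonoidHom.toAdditive (phiThetaPoints A hΘ)) hinj fun x hx₁ hx₂ h2x ↦
      h2 (Additive.toMul x) (Subgroup.mem_inf.2 ⟨hx₁, hx₂⟩) h2x
  rintro ⟨x₁, x₂⟩ ⟨hx₁, hx₂⟩ ⟨y₁, y₂⟩ ⟨hy₁, hy₂⟩ h
  have hpair := (A.pointsProdEquiv (A.dualOf Θ hΘ) ℂ).symm.injective h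
  simp only [Prod.mk.injEq, MonoidHom.prod_apply, MonoidHom.mul_apply, MonoidHom.inv_apply,
    MonoidHom.coe_fst, MonoidHom.coe_snd, MonoidHom.coe_comp, Function.comp_apply] at hpair
  have hxy := @key (⟨Additive.ofMul x₁, hx₁⟩, ⟨Additive.ofMul x₂, hx₂⟩) (⟨Additive.ofMul y₁, hy₁⟩, ⟨Additive.ofMul y₂, hy₂⟩)
    (by
      change (Additive.ofMul (x₁ / x₂), Additive.ofMul (phiThetaPoints A hΘ (x₁ * x₂))) =
        (Additive.ofMul (y₁ / y₂), Additive.ofMul (phiThetaPoints A hΘ (y₁ * y₂)))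
      rw [div_eq_mul_inv, div_eq_mul_inv, hpair.1, hpair.2])
  simp only [Prod.mk.injEq, Subtype.mk.injEq] at hxy
  exact Prod.ext hxy.1 hxy.2

/-- **`#Ḡ = #G₁ · #G₂`** in the situation of Lemma 9.3.3 (principal `Θ`, no `2`-torsion in `G₁ ∩ G₂`; Markman: `Ḡ ≅ G₁ × G₂`,
"the order `(d+1)²` of `Ḡ`"). [cite: Markman2025SecantWeil, §9.3 Lemma 9.3.3 and §1.5 (p. 7)] -/
theorem natCard_rouquierImage (hK : A.KTheta Θ = ⊥) (h2 : ∀ x ∈ G₁ ⊓ G₂, x ^ 2 = 1 → x = 1) :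
    Nat.card (rouquierImage A hΘ G₁ G₂) = Nat.card G₁ * Nat.card G₂ := by
  change Nat.card (rouquierImage A hΘ G₁ G₂ : Set ((A.prod (A.dualOf Θ hΘ)).Points ℂ)) = _
  rw [coe_rouquierImage, Nat.card_image_of_injOn (rouquierShear_injOn hK h2),
    Nat.card_congr (Equiv.Set.prod _ _), Nat.card_prod]
  rfl

/-! ## §2 The secant quotient `Y = (A × Â)/Ḡ` and its isogeny `q` -/

variable (A hΘ G₁ G₂)
variable {n : ℕ} (hn : n ≠ 0) (h₁ : G₁ ≤ A.torsionPoints ℂ n) (h₂ : G₂ ≤ A.torsionPoints ℂ n)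

/-- **Markman's quotient `Y := (X × X̂)/Ḡ`** for `X = A` polarized by the ample `Θ`, `G₁, G₂ ≤ A[n](ℂ)`: the tree's quotient
carrier `torsionQuot` of `A × Â` by `Ḡ ⊆ (A × Â)[n](ℂ)` ("Let `q : X × X̂ → Y := (X × X̂)/Ḡ` be the quotient morphism", §1.5).
[cite: Markman2025SecantWeil, §1.5 (p. 7: Y := (X × X̂)/Ḡ)] [cite: MilneAV2008, I §8 Rem. 8.12 (p. 39)] -/
def secantQuotient : AbelianVariety ℂ :=
  (A.prod (A.dualOf Θ hΘ)).torsionQuot hn (rouquierImage A hΘ G₁ G₂) (rouquierImage_le_torsionPoints h₁ h₂)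

/-- **The quotient isogeny `q : A × Â → Y = (A × Â)/Ḡ`.** [cite: Markman2025SecantWeil, §1.5 (p. 7: the quotient morphism q)] -/
def secantQuotientMap : A.prod (A.dualOf Θ hΘ) ⟶ secantQuotient A hΘ G₁ G₂ hn h₁ h₂ :=
  (A.prod (A.dualOf Θ hΘ)).torsionQuotHom hn (rouquierImage A hΘ G₁ G₂) (rouquierImage_le_torsionPoints h₁ h₂)

/-- `q` is an isogeny. [cite: MumfordAV1970, §7 Thm. 4 p. 72] -/
theorem isIsogeny_secantQuotientMap : IsIsogeny (secantQuotientMap A hΘ G₁ G₂ hn h₁ h₂) :=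
  (A.prod (A.dualOf Θ hΘ)).isIsogeny_torsionQuotHom _ _ _

/-- **`Ker q (ℂ) = Ḡ`.** [cite: MumfordAV1970, §7 Thm. 4 p. 72] [cite: Markman2025SecantWeil, §1.5 (p. 7)] -/
theorem ker_monoidHom_secantQuotientMap :
    (IsMonHom.monoidHom (secantQuotientMap A hΘ G₁ G₂ hn h₁ h₂).hom.hom.hom (specOver ℂ ℂ)).ker =
      rouquierImage A hΘ G₁ G₂ :=
  (A.prod (A.dualOf Θ hΘ)).ker_monoidHom_torsionQuotHom _ _ _

/-- `dim Y = dim A + dim A` (`Y` is isogenous to `A × Â`, `dim Â = dim A`; Markman: `Y` an abelian sixfold for `dim X = 3`).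
[cite: Markman2025SecantWeil, §1.5 (p. 7)] -/
theorem dim_secantQuotient (hprod : (A.prod (A.dualOf Θ hΘ)).dim = A.dim + (A.dualOf Θ hΘ).dim) :
    (secantQuotient A hΘ G₁ G₂ hn h₁ h₂).dim = A.dim + A.dim := by
  rw [secantQuotient, dim_torsionQuot, hprod, A.dim_dualOf hΘ]

/-- **`q^* : Hᵏ(Y(ℂ); ℂ) → Hᵏ((A × Â)(ℂ); ℂ)` is bijective** — a class `h_Y` on `Y` is the same datum as the `Ḡ`-invariant…
indeed ANY class `q^*h_Y` on `A × Â` (translations act trivially on cohomology; here simply: `q` is an isogeny).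
[cite: vanGeemen1994HodgeAV, §3.6 (p. 236)] -/
theorem complexBetti_map_secantQuotientMap_bijective (k : ℕ) :
    Function.Bijective (complexBetti.map (secantQuotientMap A hΘ G₁ G₂ hn h₁ h₂).hom.hom.hom k) :=
  (A.prod (A.dualOf Θ hΘ)).complexBetti_map_torsionQuotHom_bijective _ _ _ k

/-- `q^*` is a bijection of the rational `(p,p)`-classes of `Y` onto those of `A × Â`. [cite: vanGeemen1994HodgeAV, §3.6 (p. 236)] -/
theorem bijOn_hodgeClasses_secantQuotientMap (p : ℕ) :
    Set.BijOn (complexBetti.map (secantQuotientMap A hΘ G₁ G₂ hn h₁ h₂).hom.hom.hom (2 * p))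
      {c | IsRationalClass c ∧ IsOfHodgeType (secantQuotient A hΘ G₁ G₂ hn h₁ h₂).dim
        (secantQuotient A hΘ G₁ G₂ hn h₁ h₂).X (2 * p) p p c}
      {c | IsRationalClass c ∧ IsOfHodgeType (A.prod (A.dualOf Θ hΘ)).dim (A.prod (A.dualOf Θ hΘ)).X (2 * p) p p c} :=
  (A.prod (A.dualOf Θ hΘ)).bijOn_hodgeClasses_torsionQuotHom _ _ _ p

/-- **`[n]` factors through `q`**: `∃ r : Y → A × Â` with `q ≫ r = n • 𝟙` (the `K`-action and the sheaves are carried to `Y`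
"up to the isogeny `q`"). [cite: MilneAV2008, I §8 Rem. 8.6 and Rem. 8.12 (pp. 36–39)] -/
theorem exists_secantQuotientMap_comp_eq_zsmul_id :
    ∃ r : secantQuotient A hΘ G₁ G₂ hn h₁ h₂ ⟶ A.prod (A.dualOf Θ hΘ),
      secantQuotientMap A hΘ G₁ G₂ hn h₁ h₂ ≫ r = (n : ℤ) • 𝟙 (A.prod (A.dualOf Θ hΘ)) :=
  (A.prod (A.dualOf Θ hΘ)).exists_torsionQuotHom_comp_eq_zsmul_id _ _ _

/-! ## §3 The split Weil operator `φ_d : (x, y) ↦ (−d·φ_Θ⁻¹ y, φ_Θ x)` on `A × Â` (principal `Θ`) and its descent to `Y` -/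

variable {A G₁ G₂ hn h₁ h₂}

/-- **`η(√−d) = φ_d : (x, y) ↦ (−d·φ_Θ⁻¹(y), φ_Θ(x))` on `A × Â`** for a PRINCIPAL `Θ` (`K(Θ) = 0`, so `φ_Θ : A ⥲ Â` is an
isomorphism, `Motives/AbelianVarietyDualQuotient`): the split Weil structure of the secant anchor (the tree's
`HodgeTheory/WeilClassesLocalAnchor` witness paragraph: "`ψ₀ = φ_d : (x, y) ↦ (−d θ⁻¹y, θx)`, `φ_d² = −d`, `θ` the principal
polarization"; Markman §3.2, `f = η(√−d)`, with p. 16 "`−θ` is the pullback homomorphism associated to the isogeny `φ_L`").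
[cite: Markman2025SecantWeil, §3.2 (the operator f with f² = −d) and §3.1 (p. 16: θ and φ_L)] -/
def weilOperator (hK : A.KTheta Θ = ⊥) (d : ℕ) : A.prod (A.dualOf Θ hΘ) ⟶ A.prod (A.dualOf Θ hΘ) :=
  haveI := A.isIso_phiTheta_of_KTheta_eq_bot hΘ hK
  prodLift (-((d : ℤ) • (snd A (A.dualOf Θ hΘ) ≫ inv (A.phiTheta Θ hΘ))))
    (fst A (A.dualOf Θ hΘ) ≫ A.phiTheta Θ hΘ)

/-- First component: `φ_d ≫ p₁ = −d·(p₂ ≫ φ_Θ⁻¹)`. [cite: Markman2025SecantWeil, §3.2] -/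
theorem weilOperator_fst (hK : A.KTheta Θ = ⊥) (d : ℕ) :
    haveI := A.isIso_phiTheta_of_KTheta_eq_bot hΘ hK
    weilOperator hΘ hK d ≫ fst A (A.dualOf Θ hΘ) = -((d : ℤ) • (snd A (A.dualOf Θ hΘ) ≫ inv (A.phiTheta Θ hΘ))) :=
  prodLift_fst _ _

/-- Second component: `φ_d ≫ p₂ = p₁ ≫ φ_Θ`. [cite: Markman2025SecantWeil, §3.2] -/
theorem weilOperator_snd (hK : A.KTheta Θ = ⊥) (d : ℕ) :
    weilOperator hΘ hK d ≫ snd A (A.dualOf Θ hΘ) = fst A (A.dualOf Θ hΘ) ≫ A.phiTheta Θ hΘ :=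
  prodLift_snd _ _

/-- **`φ_d ≫ φ_d = −(d • 𝟙)`: `η(√−d)² = −d`** on `A × Â`. [cite: Markman2025SecantWeil, §3.2 (f² = −d; Cor. 3.2.3 f^*Ξ_P = dΞ_P)] -/
theorem weilOperator_comp_self (hK : A.KTheta Θ = ⊥) (d : ℕ) :
    weilOperator hΘ hK d ≫ weilOperator hΘ hK d = -((d : ℤ) • 𝟙 (A.prod (A.dualOf Θ hΘ))) := by
  haveI := A.isIso_phiTheta_of_KTheta_eq_bot hΘ hK
  apply prod_hom_ext
  · rw [Category.assoc, weilOperator_fst, Preadditive.comp_neg, Preadditive.comp_zsmul, ← Category.assoc,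
      weilOperator_snd, Category.assoc, IsIso.hom_inv_id, Category.comp_id, Preadditive.neg_comp,
      Preadditive.zsmul_comp, Category.id_comp]
  · rw [Category.assoc, weilOperator_snd, ← Category.assoc, weilOperator_fst, Preadditive.neg_comp,
      Preadditive.zsmul_comp, Category.assoc, IsIso.inv_hom_id, Category.comp_id, Preadditive.neg_comp,
      Preadditive.zsmul_comp, Category.id_comp]

/-- **Descent of an operator along the quotient, up to the isogeny**: if `ψ ≫ ψ = c • 𝟙` on `B` and `t : B → Y` is an
isogeny with `t ≫ r = n • 𝟙_B`, then `ψ_Y := r ≫ ψ ≫ t` satisfies `ψ_Y ≫ ψ_Y = (n·n·c) • 𝟙_Y` (for `B = A × Â`, `t = q`,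
`ψ = φ_d`: a `ℚ(√−d)`-structure on `Y` with `ψ_Y² = −d n²`; "the `K`-action … carried to `Y` through `q`").
[cite: MumfordAV1970, §19 (Remark p. 169: quasi-inverse of an isogeny)] [cite: Markman2025SecantWeil, §1.5 (p. 7: q induces a local isomorphism of Kuranishi spaces)] -/
theorem comp_self_of_descent {B Y : AbelianVariety ℂ} {t : B ⟶ Y} (ht : IsIsogeny t) {r : Y ⟶ B} {n c : ℤ}
    (htr : t ≫ r = n • 𝟙 B) {ψ : B ⟶ B} (hψ : ψ ≫ ψ = c • 𝟙 B) :
    (r ≫ ψ ≫ t) ≫ (r ≫ ψ ≫ t) = (n * n * c) • 𝟙 Y := by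
  -- `r ≫ t = n • 𝟙_Y` since `t` is an epimorphism among homomorphisms
  have hrt : r ≫ t = n • 𝟙 Y := by
    apply ht.cancel_left
    rw [← Category.assoc, htr, Preadditive.zsmul_comp, Category.id_comp, Preadditive.comp_zsmul, Category.comp_id]
  calc (r ≫ ψ ≫ t) ≫ (r ≫ ψ ≫ t)
      = r ≫ ψ ≫ (t ≫ r) ≫ ψ ≫ t := by simp only [Category.assoc]
    _ = n • (r ≫ (ψ ≫ ψ) ≫ t) := by
        rw [htr, Preadditive.zsmul_comp, Category.id_comp, Preadditive.comp_zsmul, Preadditive.comp_zsmul]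
        simp only [Category.assoc]
    _ = (n * c) • (r ≫ t) := by
        rw [hψ, Preadditive.zsmul_comp, Category.id_comp, Preadditive.comp_zsmul, smul_smul]
    _ = (n * n * c) • 𝟙 Y := by rw [hrt, smul_smul]; ring_nf

/-! ## §4 Predicates for the genus-3 secant anchor (ring-2 consumers) -/

/-- The translate `t_x(Supp Θ)` of the support `Supp Θ = A ∖ A_{1}` of an effective Cartier divisor `Θ` by a complex point
`x` (Markman's `τ_x(Θ)`). [cite: Markman2025SecantWeil, §9.3 Lemma 9.3.1 (proof: the translates τ_{g₁+g₂}(Θ))] -/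
def thetaTranslate (A : AbelianVariety ℂ) (Θ : CartierDivisor A.X.left) (x : A.Points ℂ) : Set A.X.left :=
  (A.translation x).left.base '' (Θ.nonvanishing 1)ᶜ

/-- **The translates `τ_s(Θ)`, `s ∈ S`, are in general position** in the sense of the proof of Lemma 9.3.1: any four
translates by pairwise distinct points of `S` have empty intersection, and any three have finite intersection (for
`S = {g₁ + g₂ | (g₁, g₂) ∈ G₁ × G₂}` this is Markman's sufficient condition for Assumption 9.2.1 (1), and "the property is
open in moduli"). The TYPABLE part of Markman's genericity hypotheses. [cite: Markman2025SecantWeil, §9.3 Lemma 9.3.1 (proof) and §9.2 Assumption 9.2.1 (1)] -/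
def TranslatesInGeneralPosition (A : AbelianVariety ℂ) (Θ : CartierDivisor A.X.left) (S : Set (A.Points ℂ)) : Prop :=
  (∀ s₁ ∈ S, ∀ s₂ ∈ S, ∀ s₃ ∈ S, ∀ s₄ ∈ S, s₁ ≠ s₂ → s₁ ≠ s₃ → s₁ ≠ s₄ → s₂ ≠ s₃ → s₂ ≠ s₄ → s₃ ≠ s₄ →
      thetaTranslate A Θ s₁ ∩ thetaTranslate A Θ s₂ ∩ thetaTranslate A Θ s₃ ∩ thetaTranslate A Θ s₄ = ∅) ∧
  (∀ s₁ ∈ S, ∀ s₂ ∈ S, ∀ s₃ ∈ S, s₁ ≠ s₂ → s₁ ≠ s₃ → s₂ ≠ s₃ →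
      (thetaTranslate A Θ s₁ ∩ thetaTranslate A Θ s₂ ∩ thetaTranslate A Θ s₃).Finite)

/-- The set of sums `{g₁ + g₂}` (multiplicatively `g₁ g₂`) over `G₁ × G₂` — the index set of Markman's `(d+1)²` translates.
[cite: Markman2025SecantWeil, §9.3 Lemma 9.3.1 (proof)] -/
def sumSet (G₁ G₂ : Subgroup (A.Points ℂ)) : Set (A.Points ℂ) :=
  {s | ∃ g₁ ∈ G₁, ∃ g₂ ∈ G₂, s = g₁ * g₂}

/-- **`Y` is a secant-quotient sixfold of level `d`** (the SHAPE of Markman's anchor `Y_d`): there are a smooth projective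
complex curve `C` (`IsSmoothProjective 1 C`), a Jacobian `𝒥` of `C` of dimension `3`, a Riemann theta divisor `Θ` of `𝒥`
which is a principal polarization divisor (`Motives/JacobianThetaDivisor`, `Motives/AbelianVarietyPrincipalPolarization`),
cyclic subgroups `G₁, G₂ ≤ J[d+1](ℂ)` of order `d+1` with `G₁ ⊓ G₂ = ⊥`, and an isomorphism `Y ≅ (J × Ĵ)/Ḡ`. ENVELOPE of
the anchors of §1.5 / Thm. 1.4.1 — "generic non-hyperelliptic `C`", Lemma 9.3.1's general position and "`d` even" are NOT
part of it (module docstring: conjoin `TranslatesInGeneralPosition J Θ (sumSet G₁ G₂)` and parity as needed).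
[cite: Markman2025SecantWeil, §1.5 (p. 7) and §9.3 (p. 70)] -/
def IsSecantQuotientSixfold (d : ℕ) (Y : AbelianVariety ℂ) : Prop :=
  ∃ (C : SchemeOver ℂ) (_ : IsSmoothProjective 1 C) (𝒥 : Jacobian C) (_ : 𝒥.J.dim = 3)
    (Θ : CartierDivisor 𝒥.J.X.left) (_ : 𝒥.IsRiemannThetaDivisor Θ) (hP : 𝒥.J.IsPrincipalPolarizationDivisor Θ)
    (G₁ G₂ : Subgroup (𝒥.J.Points ℂ)) (h₁ : G₁ ≤ 𝒥.J.torsionPoints ℂ (d + 1 : ℕ))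
    (h₂ : G₂ ≤ 𝒥.J.torsionPoints ℂ (d + 1 : ℕ)),
    IsCyclic G₁ ∧ Nat.card G₁ = d + 1 ∧ IsCyclic G₂ ∧ Nat.card G₂ = d + 1 ∧ G₁ ⊓ G₂ = ⊥ ∧
    Nonempty (Y ≅ secantQuotient 𝒥.J hP.isAmple G₁ G₂ (Nat.succ_ne_zero d) h₁ h₂)

/-- In the situation of `IsSecantQuotientSixfold`, `G₁ ⊓ G₂ = ⊥` gives the hypothesis of Lemma 9.3.3 for free, so
`#Ḡ = (d+1)²`. [cite: Markman2025SecantWeil, §9.3 Lemma 9.3.3 and §1.5 (p. 7: the order (d+1)² of Ḡ)] -/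
theorem natCard_rouquierImage_of_inf_eq_bot (hK : A.KTheta Θ = ⊥) {G₁ G₂ : Subgroup (A.Points ℂ)} (h : G₁ ⊓ G₂ = ⊥) :
    Nat.card (rouquierImage A hΘ G₁ G₂) = Nat.card G₁ * Nat.card G₂ :=
  natCard_rouquierImage hK fun x hx _ ↦ by rwa [h, Subgroup.mem_bot] at hx

end Literature.AlgebraicGeometry.Markman2025

end
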